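import Summits.ResolutionOfSingularities.ResolutionOfSingularities.Theorems.EquisingularLiftCampaignW45bEquisingularLiftNatLeTwoOnePoint
import Summits.ResolutionOfSingularities.ResolutionOfSingularities.Theorems.EquisingularLiftEquisingularLiftCurveCase
import Summits.ResolutionOfSingularities.ResolutionOfSingularities.Theorems.EquisingularLiftCampaignW45bEquisingularLiftNat
import Summits.ResolutionOfSingularities.ResolutionOfSingularities.Theses.EquisingularLift
import HarnessLib

/-!
# [OURS · L1 W4.5(b)] EL♮ FIRST RUNG, E2 form — `EquisingularLiftNatSmooth` holds for `n ≤ 2`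

Crux chain w45b, working crux EL♮ = `Theses.EquisingularLift.EquisingularLiftNat` (item stmt-ResolutionOfSingularities-20038,
route rev 3), line `sections` (`SkeletonELnat-v1.lean` d2ae315ead614bb4, registered by res-L1-w45b-lead-2), first rung `n ≤ 2`.
This file proves the rung in the chain's WORKING STRENGTHENING E2 = `Theorems.EquisingularLiftNatSmooth p` (res-L1-type-o1,
p482511/p484593: E1 «special support of the centre ⊆ current strict transform» AND «the centre is `O`-SMOOTH»), restricted to
`n ≤ 2` — CHAIN v5 §3 / CRUX-PLAN v3 (P3) «E2 = the working strengthening for rungs where sections suffice (n ≤ 2)». The E1 stub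
`stub_elnat_le_two` itself is filed BY NAME by its holder of record (res-D-pv-022 as res-L1-w45b-stub-5, CHAIN v6.1 §3); E2-chains
are E1-chains, so this file also yields it by the 8-line nesting of `Theorems.equisingularLiftNat_of_smooth` (not restated here to
avoid a duplicate). OURS; NOT a statement of any manuscript; AI-written, weaker than expert review. `--supports stmt-…-20038`.

THE MATHEMATICS is the landed curve case of the typed door (p171618 `StrataSplit.equisingularLift_of_le_two`: `O := 𝕎(k)`,
`P := ℙⁿ_O`, blow-ups along Hensel SECTIONS through the non-regular points of the successive strict transforms of the plane
curve; strong induction on the number of non-regular points, inner induction on the total `δ`-invariant), re-run with the two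
extra step clauses packaged as ONE admissibility predicate fed to part 1 (`resolveOnePoint_dimOne_adm`, p498031):
* E1 — a section `s ≅ Spec O` through a point `w ∈ Y'` has special support `{w}`;
* E2 — `V(ker s) ≅ Spec O` over `Spec O` (`Scheme.Hom.toImage` is an isomorphism for the closed immersion `s`), hence smooth.

* `adm_of_section` — E1 ∧ E2 for the kernel of a section through a point of `Y'`;
* `isolatedPointDrop_dimOne_adm` — `StrataSplit.isolatedPointDrop_dimOne` with admissibility threaded;
* `elnat_le_two_smooth` — **EL♮ with `O`-smooth centres (E2) for `n ≤ 2`**, in the FIXED `ℙⁿ_O` with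
  `Y := range (ι ≫ Proj.map φ)` for every admissible graded `φ` (plumbing of `Theorems.equisingularLift_of_equisingularLiftNatA`).
-/

set_option linter.dupNamespace false -- mandated namespace `Summit.<Summit>.<Problem>` of this single-conjunct summit
set_option linter.overlappingInstances false -- signatures carry `[IsDomain O] [IsDiscreteValuationRing O]`

noncomputable section

open CategoryTheory CategoryTheory.Limits AlgebraicGeometry TopologicalSpace Topology
open MvPolynomial HomogeneousIdeal
open Literature.AlgebraicGeometry.Resolution
open AlgebraicGeometry.Scheme.IdealSheafData
open Summit.ResolutionOfSingularities.ResolutionOfSingularities.Theses.EquisingularLift.Split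
open Summit.ResolutionOfSingularities.ResolutionOfSingularities.Cruxes.EquisingularLift.StrataSplit

namespace Summit.ResolutionOfSingularities.ResolutionOfSingularities.Cruxes.EquisingularLiftNat.Sections

/-! ## E1 ∧ E2 for section centres -/

/-- **Kernels of sections are E1 ∧ E2 centres.** For a closed immersion `s : Spec O → X'` which is a section of
`σ' ≫ q : X' → Spec O` and passes through a point of `Y'` at the closed point: the special-fibre points of `V(ker s)` lie in
`Y'` (the support of `ker s` is the range of `s`, whose only special point is `s(closed point)`), and `V(ker s) → Spec O` is
smooth (it is the isomorphism `inv s.toImage`). [folklore] -/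
theorem adm_of_section {O : Type} [CommRing O] [IsLocalRing O] {P X' : Scheme.{0}}
    (q : P ⟶ Spec (.of O)) (σ' : X' ⟶ P) (Y' : Set X') (s : Spec (.of O) ⟶ X') [IsClosedImmersion s]
    (hs : s ≫ σ' ≫ q = 𝟙 _) (hsY : s (IsLocalRing.closedPoint O) ∈ Y') :
    (s.ker.support : Set X') ∩ (σ' ≫ q) ⁻¹' {IsLocalRing.closedPoint O} ⊆ Y' ∧
      Smooth (s.ker.subschemeι ≫ σ' ≫ q) := by
  constructor
  · rintro c ⟨hc, hcs⟩
    have hsupp : (s.ker.support : Set X') = Set.range s := by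
      rw [Scheme.Hom.support_ker, s.isClosedEmbedding.isClosed_range.closure_eq]
    rw [hsupp] at hc
    obtain ⟨t, rfl⟩ := hc
    have ht : (σ' ≫ q) (s t) = t := by
      rw [← Scheme.Hom.comp_apply, hs]; rfl
    have hts : t = IsLocalRing.closedPoint O := by
      have h : (σ' ≫ q) (s t) ∈ ({IsLocalRing.closedPoint O} : Set _) := hcs
      rwa [ht] at h
    rw [hts]
    exact hsY
  · have h1 : s.toImage ≫ s.ker.subschemeι = s := s.toImage_imageι
    have h2 : s.ker.subschemeι ≫ σ' ≫ q = inv s.toImage := by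
      rw [← cancel_epi s.toImage, ← Category.assoc, h1, hs, IsIso.hom_inv_id]
    rw [h2]
    infer_instance

/-! ## Child 2 for curves, admissibility threaded -/

/-- **`StrataSplit.isolatedPointDrop_dimOne` with step admissibility threaded**: from a stage with `≥ 1` non-regular point
of the reduced strict transform (a curve), a further chain over `(P₁, closure S₁)` ALL OF WHOSE STEPS ARE ADMISSIBLE strictly
lowers the number of non-regular points, keeping `dim ≤ 1`, irreducibility of the special fibre, finiteness and good
reduction — provided kernels of sections through points of the current strict transform are admissible. Proof verbatim the
landed one over `resolveOnePoint_dimOne_adm` and `regularOverIso`. [folklore] -/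
theorem isolatedPointDrop_dimOne_adm : ∀ (O : Type) [CommRing O] [IsDomain O] [IsDiscreteValuationRing O] [CharZero O] [IsAdicComplete (IsLocalRing.maximalIdeal O) O] [IsAlgClosed (IsLocalRing.ResidueField O)] (P P₁ : AlgebraicGeometry.Scheme.{0}) (q : P ⟶ AlgebraicGeometry.Spec (.of O)) (Y : TopologicalSpace.Closeds P) (σ₁ : P₁ ⟶ P) (S₁ : Set P₁), AlgebraicGeometry.Smooth q → AlgebraicGeometry.IsProper q → (Y : Set P) ⊆ q ⁻¹' {IsLocalRing.closedPoint O} → IsIrreducible (Y : Set P) → Chain P (Y : Set P) P₁ σ₁ S₁ → IsIrreducible (((CategoryTheory.CategoryStruct.comp σ₁ q)) ⁻¹' {IsLocalRing.closedPoint O}) → (singSet S₁).Finite → GoodSet ((CategoryTheory.CategoryStruct.comp σ₁ q)) S₁ → topologicalKrullDim ↥(AlgebraicGeometry.Scheme.IdealSheafData.vanishingIdeal (⟨closure S₁, isClosed_closure⟩ : TopologicalSpace.Closeds P₁)).subscheme ≤ 1 → ∀ (Adm : ∀ X' : AlgebraicGeometry.Scheme.{0}, (X' ⟶ P₁) → Set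 X' → X'.IdealSheafData → Prop), (∀ (X' : AlgebraicGeometry.Scheme.{0}) (σ' : X' ⟶ P₁) (Y' : Set X') (s : AlgebraicGeometry.Spec (.of O) ⟶ X'), AlgebraicGeometry.IsClosedImmersion s → CategoryTheory.CategoryStruct.comp s (CategoryTheory.CategoryStruct.comp σ' (CategoryTheory.CategoryStruct.comp σ₁ q)) = CategoryTheory.CategoryStruct.id _ → s (IsLocalRing.closedPoint O) ∈ Y' → Adm X' σ' Y' s.ker) → (singSet S₁).Nonempty → ∃ (P₂ : AlgebraicGeometry.Scheme.{0}) (σ₂ : P₂ ⟶ P₁) (S₂ : Set P₂), topologicalKrullDim ↥(AlgebraicGeometry.Scheme.IdealSheafData.vanishingIdeal (⟨closure S₂, isClosed_closure⟩ : TopologicalSpace.Closeds P₂)).subscheme ≤ 1 ∧ (∀ Q : (∀ X' : AlgebraicGeometry.Scheme.{0}, (X' ⟶ P₁) → Set X' → Prop), Q P₁ (CategoryTheory.CategoryStruct.id P₁) (closure S₁) → (∀ (X' X'' : AlgebraicGeometry.Scheme.{0}) (σ' : X' ⟶ P₁) (Y' : Set X') (C : X'.IdealSheafData) (τ : X'' ⟶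 X'), Q X' σ' Y' → Literature.AlgebraicGeometry.Resolution.IsBlowup τ C → Literature.AlgebraicGeometry.Resolution.Scheme.IsRegular C.subscheme → σ' '' (C.support : Set X') ⊆ {x : P₁ | ¬ IsGenericPoint x (closure S₁)} → Adm X' σ' Y' C → Q X'' (CategoryTheory.CategoryStruct.comp τ σ') (closure (τ ⁻¹' (Y' \ (C.support : Set X'))))) → Q P₂ σ₂ S₂) ∧ IsIrreducible (((CategoryTheory.CategoryStruct.comp (CategoryTheory.CategoryStruct.comp σ₂ σ₁) q)) ⁻¹' {IsLocalRing.closedPoint O}) ∧ (singSet S₂).Finite ∧ GoodSet (CategoryTheory.CategoryStruct.comp (CategoryTheory.CategoryStruct.comp σ₂ σ₁) q) S₂ ∧ (singSet S₂).ncard < (singSet S₁).ncard := by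
  classical
  have h1 := resolveOnePoint_dimOne_adm
  intro O _ _ _ _ _ _ P P₁ q Y σ₁ S₁ hq hqp hY hYirr hch₁ hirr₁ hfin₁ hgood₁ hdim₁ Adm hAdm hne
  obtain ⟨x₀, hx₀⟩ := hne
  obtain ⟨P₂, σ₂, S₂, hdim₂, hch₂, hirr₂, V, hV, hiso, hreg₀⟩ :=
    h1 O P P₁ q Y σ₁ S₁ hq hqp hY hYirr hch₁ hirr₁ hfin₁ hgood₁ hdim₁ Adm hAdm x₀ hx₀
  have hch₂C : Chain P₁ (closure S₁) P₂ σ₂ S₂ := admChain_chain Adm hch₂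
  -- generic points: `Y = closure {ξ}`, `closure S₁ = closure {ξ₁}`, `S₂ = closure {ξ₂}`, `σ₂ ξ₂ = ξ₁`
  obtain ⟨ξ, hξ⟩ : ∃ ξ : P, IsGenericPoint ξ (Y : Set P) := QuasiSober.sober hYirr Y.isClosed
  obtain ⟨ξ₁, hfib₁, hS₁⟩ := Chain.fibre hch₁ hξ
  have hcl₁ : closure S₁ = closure {ξ₁} := by rw [hS₁, closure_closure]
  have hgen₁ : IsGenericPoint ξ₁ (closure S₁) := by rw [isGenericPoint_def, hcl₁]
  have hirrS₁ : IsIrreducible (closure S₁) := by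
    rw [hcl₁]; exact isIrreducible_singleton.closure
  obtain ⟨ξ₂, hfib₂, hS₂⟩ := Chain.fibre hch₂C hgen₁
  have hσξ₂ : σ₂ ξ₂ = ξ₁ := by
    have : ξ₂ ∈ σ₂ ⁻¹' {ξ₁} := by rw [hfib₂]; rfl
    simpa using this
  -- the two reduced strict transforms and their inclusions
  have hrange₁ : Set.range (AlgebraicGeometry.Scheme.IdealSheafData.vanishingIdeal (⟨closure S₁, isClosed_closure⟩ : TopologicalSpace.Closeds P₁)).subschemeι = closure S₁ := by
    rw [Scheme.IdealSheafData.range_subschemeι, Scheme.IdealSheafData.coe_support_vanishingIdeal]; rfl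
  have hrange₂ : Set.range (AlgebraicGeometry.Scheme.IdealSheafData.vanishingIdeal (⟨closure S₂, isClosed_closure⟩ : TopologicalSpace.Closeds P₂)).subschemeι = closure S₂ := by
    rw [Scheme.IdealSheafData.range_subschemeι, Scheme.IdealSheafData.coe_support_vanishingIdeal]; rfl
  -- every point of the new strict transform lies over the old one
  have hcl₂ : closure S₂ = closure {ξ₂} := by rw [hS₂, closure_closure]
  have himg : ∀ z : ↥(AlgebraicGeometry.Scheme.IdealSheafData.vanishingIdeal (⟨closure S₂, isClosed_closure⟩ : TopologicalSpace.Closeds P₂)).subscheme, (σ₂ ((AlgebraicGeometry.Scheme.IdealSheafData.vanishingIdeal (⟨closure S₂, isClosed_closure⟩ : TopologicalSpace.Closeds P₂)).subschemeι z) : P₁) ∈ closure S₁ := by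
    intro z
    have hz : ((AlgebraicGeometry.Scheme.IdealSheafData.vanishingIdeal (⟨closure S₂, isClosed_closure⟩ : TopologicalSpace.Closeds P₂)).subschemeι z : P₂) ∈ closure S₂ := (Set.ext_iff.mp hrange₂ _).mp (Set.mem_range_self z)
    have hz' : ((AlgebraicGeometry.Scheme.IdealSheafData.vanishingIdeal (⟨closure S₂, isClosed_closure⟩ : TopologicalSpace.Closeds P₂)).subschemeι z : P₂) ∈ closure ({ξ₂} : Set P₂) := (Set.ext_iff.mp hcl₂ _).mp hz
    have h' : (σ₂ ((AlgebraicGeometry.Scheme.IdealSheafData.vanishingIdeal (⟨closure S₂, isClosed_closure⟩ : TopologicalSpace.Closeds P₂)).subschemeι z) : P₁) ∈ closure (σ₂ '' {ξ₂}) :=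
      image_closure_subset_closure_image σ₂.continuous ⟨_, hz', rfl⟩
    rw [Set.image_singleton, hσξ₂] at h'
    exact (Set.ext_iff.mp hcl₁ _).mpr h'
  have hx : ∀ z : ↥(AlgebraicGeometry.Scheme.IdealSheafData.vanishingIdeal (⟨closure S₂, isClosed_closure⟩ : TopologicalSpace.Closeds P₂)).subscheme, ∃ x : ↥(AlgebraicGeometry.Scheme.IdealSheafData.vanishingIdeal (⟨closure S₁, isClosed_closure⟩ : TopologicalSpace.Closeds P₁)).subscheme, ((AlgebraicGeometry.Scheme.IdealSheafData.vanishingIdeal (⟨closure S₁, isClosed_closure⟩ : TopologicalSpace.Closeds P₁)).subschemeι x : P₁) = σ₂ ((AlgebraicGeometry.Scheme.IdealSheafData.vanishingIdeal (⟨closure S₂, isClosed_closure⟩ : TopologicalSpace.Closeds P₂)).subschemeι z) := by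
    intro z
    have hz : (σ₂ ((AlgebraicGeometry.Scheme.IdealSheafData.vanishingIdeal (⟨closure S₂, isClosed_closure⟩ : TopologicalSpace.Closeds P₂)).subschemeι z) : P₁) ∈ Set.range (AlgebraicGeometry.Scheme.IdealSheafData.vanishingIdeal (⟨closure S₁, isClosed_closure⟩ : TopologicalSpace.Closeds P₁)).subschemeι := (Set.ext_iff.mp hrange₁ _).mpr (himg z)
    obtain ⟨x, hx⟩ := hz
    exact ⟨x, hx⟩
  choose f hf using hx
  -- `f` maps the new non-regular points into the old ones minus `x₀`, injectively
  have hne₀ : ∀ z ∈ singSet S₂, f z ≠ x₀ := by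
    intro z hz h0
    exact hz (hreg₀ z (by rw [← hf z, h0]))
  have hfV : ∀ z ∈ singSet S₂, ((AlgebraicGeometry.Scheme.IdealSheafData.vanishingIdeal (⟨closure S₁, isClosed_closure⟩ : TopologicalSpace.Closeds P₁)).subschemeι (f z) : P₁) ∈ V := fun z hz => hV (f z) (hne₀ z hz)
  have hmaps : ∀ z ∈ singSet S₂, f z ∈ singSet S₁ \ {x₀} := by
    intro z hz
    refine ⟨?_, hne₀ z hz⟩
    intro hreg
    exact hz ((regularOverIso O P₁ P₂ ((CategoryTheory.CategoryStruct.comp σ₁ q)) σ₂ S₁ S₂ V hirrS₁ hch₂C hiso z (f z) (hf z).symm (hfV z hz)).1.mpr hreg)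
  have hinj : Set.InjOn f (singSet S₂) := by
    intro z hz z' hz' hzz'
    obtain ⟨w, -, huniq⟩ := existsUnique_preimage σ₂ hiso (hfV z hz)
    have e1 : ((AlgebraicGeometry.Scheme.IdealSheafData.vanishingIdeal (⟨closure S₂, isClosed_closure⟩ : TopologicalSpace.Closeds P₂)).subschemeι z : P₂) = w := huniq _ (hf z).symm
    have e2 : ((AlgebraicGeometry.Scheme.IdealSheafData.vanishingIdeal (⟨closure S₂, isClosed_closure⟩ : TopologicalSpace.Closeds P₂)).subschemeι z' : P₂) = w := huniq _ (by rw [hzz', hf z'])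
    exact (AlgebraicGeometry.Scheme.IdealSheafData.vanishingIdeal (⟨closure S₂, isClosed_closure⟩ : TopologicalSpace.Closeds P₂)).subschemeι.isClosedEmbedding.injective (e1.trans e2.symm)
  have hfin' : (singSet S₁ \ {x₀}).Finite := hfin₁.subset Set.sdiff_subset
  have hfin₂ : (singSet S₂).Finite := by
    have himf : (f '' singSet S₂).Finite := hfin'.subset (by rintro _ ⟨z, hz, rfl⟩; exact hmaps z hz)
    exact (Set.finite_image_iff hinj).mp himf
  have hle : (singSet S₂).ncard ≤ (singSet S₁ \ {x₀}).ncard := Set.ncard_le_ncard_of_injOn f hmaps hinj hfin'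
  have hlt : (singSet S₁ \ {x₀}).ncard < (singSet S₁).ncard := Set.ncard_sdiff_singleton_lt_of_mem hx₀ hfin₁
  -- good reduction at the remaining non-regular points is inherited from the points under them
  have hgood₂ : GoodSet ((CategoryTheory.CategoryStruct.comp (CategoryTheory.CategoryStruct.comp σ₂ σ₁) q)) S₂ := by
    intro z hz
    have hg : GoodAt ((CategoryTheory.CategoryStruct.comp σ₁ q)) ((AlgebraicGeometry.Scheme.IdealSheafData.vanishingIdeal (⟨closure S₁, isClosed_closure⟩ : TopologicalSpace.Closeds P₁)).subschemeι (f z)) := hgood₁ (f z) (hmaps z hz).1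
    have ht := (regularOverIso O P₁ P₂ ((CategoryTheory.CategoryStruct.comp σ₁ q)) σ₂ S₁ S₂ V hirrS₁ hch₂C hiso z (f z) (hf z).symm (hfV z hz)).2.mpr hg
    rwa [← Category.assoc] at ht
  exact ⟨P₂, σ₂, S₂, hdim₂, hch₂, hirr₂, hfin₂, hgood₂, lt_of_le_of_lt hle hlt⟩


/-! ## EL♮ for `n ≤ 2` -/

/-- **EL♮ WITH `O`-SMOOTH CENTRES (E2) FOR `n ≤ 2`**: the text of `Theorems.EquisingularLiftNatSmooth p` with the extra
hypothesis `n ≤ 2` (points, `ℙ¹`, `ℙ²`, integral plane curves). `O := 𝕎(k)`; in the FIXED `ℙⁿ_O`, `Y := range (ι ≫ Proj.map φ)`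
sits in the special fibre with `V(Y) ≅ H`; if `H` is regular the empty chain answers; otherwise `H` is a curve and the chain of
blow-ups along Hensel SECTIONS through the non-regular points of the successive strict transforms (strong induction on their
number, `isolatedPointDrop_dimOne_adm`) consists of E1 ∧ E2 steps (`adm_of_section`), keeps the special fibre irreducible and
ends with a regular reduced strict transform. [folklore; classical embedded resolution of plane curves, Liu 2002 §8.1/§9.2,
Kollár 2007 §1.4] -/
theorem elnat_le_two_smooth (p : ℕ) : p.Prime → ∀ (k : Type) [Field k] [CharP k p] [IsAlgClosed k] (n : ℕ) (H : AlgebraicGeometry.Scheme.{0}) (ι : H ⟶ (Literature.AlgebraicGeometry.Motives.projectiveSpace n k).left), AlgebraicGeometry.IsClosedImmersion ι → AlgebraicGeometry.IsIntegral H → (∀ y : (Literature.AlgebraicGeometry.Motives.projectiveSpace n k).left, ∃ U : (Literature.AlgebraicGeometry.Motives.projectiveSpace n k).left.affineOpens, y ∈ (U : (Literature.AlgebraicGeometry.Motives.projectiveSpace n k).left.Opens) ∧ (ι.ker.ideal U).IsPrincipal) → n ≤ 2 → ∃ (O : Type) (_ : CommRing O) (_ : IsDomain O) (_ : IsDiscreteValuationRing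 O) (_ : CharZero O) (π : O →+* k), Function.Surjective π ∧ (letI := MvPolynomial.gradedAlgebra (σ := Fin (n + 1)) (R := O); letI := MvPolynomial.gradedAlgebra (σ := Fin (n + 1)) (R := k); ∀ (φ : MvPolynomial.homogeneousSubmodule (Fin (n + 1)) O →+*ᵍ MvPolynomial.homogeneousSubmodule (Fin (n + 1)) k) (hφ' : HomogeneousIdeal.irrelevant (MvPolynomial.homogeneousSubmodule (Fin (n + 1)) k) ≤ (HomogeneousIdeal.irrelevant (MvPolynomial.homogeneousSubmodule (Fin (n + 1)) O)).map φ), (∀ s, φ s = MvPolynomial.map π s) → ∀ Y : Set (AlgebraicGeometry.Proj (MvPolynomial.homogeneousSubmodule (Fin (n + 1)) O)), Y = Set.range (CategoryTheory.CategoryStruct.comp ι (AlgebraicGeometry.Proj.map φ hφ') : H ⟶ (AlgebraicGeometry.Proj (MvPolynomial.homogeneousSubmodule (Fin (n + 1)) O))) → ∃ (P' : AlgebraicGeometry.Scheme.{0}) (σ : P' ⟶ (AlgebraicGeometry.Proj (MvPolynomial.homogeneousSubmodule (Fin (n + 1)) O))) (S' : Set P'), (∀ Q : (∀ X' : AlgebraicGeometry.Scheme.{0},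 (X' ⟶ (AlgebraicGeometry.Proj (MvPolynomial.homogeneousSubmodule (Fin (n + 1)) O))) → Set X' → Prop), Q (AlgebraicGeometry.Proj (MvPolynomial.homogeneousSubmodule (Fin (n + 1)) O)) (CategoryTheory.CategoryStruct.id _) Y → (∀ (X' X'' : AlgebraicGeometry.Scheme.{0}) (σ' : X' ⟶ (AlgebraicGeometry.Proj (MvPolynomial.homogeneousSubmodule (Fin (n + 1)) O))) (Y' : Set X') (C : X'.IdealSheafData) (τ : X'' ⟶ X'), Q X' σ' Y' → Literature.AlgebraicGeometry.Resolution.IsBlowup τ C → Literature.AlgebraicGeometry.Resolution.Scheme.IsRegular C.subscheme → σ' '' (C.support : Set X') ⊆ {x | ¬ IsGenericPoint x Y} → (C.support : Set X') ∩ (CategoryTheory.CategoryStruct.comp σ' (CategoryTheory.CategoryStruct.comp (AlgebraicGeometry.Proj.toSpecZero (MvPolynomial.homogeneousSubmodule (Fin (n + 1)) O)) (AlgebraicGeometry.Spec.map (CommRingCat.ofHom (algebraMap O (MvPolynomial.homogeneousSubmodule (Fin (n + 1)) O 0)))))) ⁻¹' {IsLocalRing.closedPoint O} ⊆ Y' →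 AlgebraicGeometry.Smooth (CategoryTheory.CategoryStruct.comp C.subschemeι (CategoryTheory.CategoryStruct.comp σ' (CategoryTheory.CategoryStruct.comp (AlgebraicGeometry.Proj.toSpecZero (MvPolynomial.homogeneousSubmodule (Fin (n + 1)) O)) (AlgebraicGeometry.Spec.map (CommRingCat.ofHom (algebraMap O (MvPolynomial.homogeneousSubmodule (Fin (n + 1)) O 0))))))) → Q X'' (CategoryTheory.CategoryStruct.comp τ σ') (closure (τ ⁻¹' (Y' \ (C.support : Set X'))))) → Q P' σ S') ∧ IsIrreducible ((CategoryTheory.CategoryStruct.comp σ (CategoryTheory.CategoryStruct.comp (AlgebraicGeometry.Proj.toSpecZero (MvPolynomial.homogeneousSubmodule (Fin (n + 1)) O)) (AlgebraicGeometry.Spec.map (CommRingCat.ofHom (algebraMap O (MvPolynomial.homogeneousSubmodule (Fin (n + 1)) O 0)))))) ⁻¹' {IsLocalRing.closedPoint O}) ∧ Literature.AlgebraicGeometry.Resolution.Scheme.IsRegular (AlgebraicGeometry.Scheme.IdealSheafData.vanishingIdeal (⟨closure S', isClosed_closure⟩ : TopologicalSpace.Closeds P')).subscheme) := by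
  classical
  intro hp k _ _ _ n H ι hι hH hloc hn
  obtain ⟨O, i1, i2, i3, i4, i5, i6, π, hπ⟩ := stub_wittRing p hp k
  refine ⟨O, i1, i2, i3, i4, π, hπ, ?_⟩
  letI := MvPolynomial.gradedAlgebra (σ := Fin (n + 1)) (R := O)
  letI := MvPolynomial.gradedAlgebra (σ := Fin (n + 1)) (R := k)
  intro φ hφ' hφ Y hY
  subst hY
  -- the fixed ambient `P = ℙⁿ_O`, its structure map `q`, the special-fibre embedding `g`, and `Y = range (ι ≫ g)`
  set P : Scheme.{0} := Proj (homogeneousSubmodule (Fin (n + 1)) O) with hPdef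
  set q : P ⟶ Spec (.of O) :=
    Proj.toSpecZero (homogeneousSubmodule (Fin (n + 1)) O) ≫
      Spec.map (CommRingCat.ofHom (algebraMap O (homogeneousSubmodule (Fin (n + 1)) O 0))) with hqdef
  obtain ⟨hq, hqp⟩ : Smooth q ∧ IsProper q := stub_projectiveAmbientSmoothProper O n
  have hirr₀ : IsIrreducible (q ⁻¹' {IsLocalRing.closedPoint O}) := by
    obtain ⟨-, -, -, h⟩ := stub_projectiveAmbientFibre O k π hπ n H ι hι hH
    exact h
  have hPB := ProjectiveAmbientFibre.isPullback_projMap π φ hφ hπ hφ'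
  set g : Proj (homogeneousSubmodule (Fin (n + 1)) k) ⟶ P := Proj.map φ hφ' with hgdef
  haveI : IsClosedImmersion (Spec.map (CommRingCat.ofHom π)) := IsClosedImmersion.spec_of_surjective _ hπ
  haveI : IsClosedImmersion g := MorphismProperty.IsStableUnderBaseChange.of_isPullback hPB.flip inferInstance
  have hpt : ∀ x : Spec (.of k), Spec.map (CommRingCat.ofHom π) x = IsLocalRing.closedPoint O := by
    intro x
    rw [Spec.map_apply]
    apply PrimeSpectrum.ext
    rw [PrimeSpectrum.comap_asIdeal, CommRingCat.hom_ofHom, Ideal.eq_bot_of_prime x.asIdeal, ← RingHom.ker_eq_comap_bot]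
    exact IsLocalRing.eq_maximalIdeal (RingHom.ker_isMaximal_of_surjective π hπ)
  have hgq : ∀ x, q (g x) = IsLocalRing.closedPoint O := fun x ↦
    (Scheme.Hom.comp_apply g q x).symm.trans
      ((congrArg (fun h : Proj (homogeneousSubmodule (Fin (n + 1)) k) ⟶ Spec (.of O) ↦ h x) hPB.w).trans
        ((Scheme.Hom.comp_apply _ _ x).trans (hpt _)))
  haveI := hH
  let ι' : H ⟶ Proj (homogeneousSubmodule (Fin (n + 1)) k) := ι
  haveI : IsClosedImmersion ι' := hι
  let f : H ⟶ P := ι' ≫ g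
  let Yc : Closeds P := ⟨Set.range f, f.isClosedEmbedding.isClosed_range⟩
  have hsub : (Yc : Set P) ⊆ q ⁻¹' {IsLocalRing.closedPoint O} := by
    rintro _ ⟨x, rfl⟩
    show q (f x) = IsLocalRing.closedPoint O
    rw [show f x = g (ι' x) from Scheme.Hom.comp_apply _ _ x]
    exact hgq (ι' x)
  -- `V(Y) ≅ H`: `H` is reduced, so the kernel of the closed immersion `f` is the vanishing ideal sheaf of its range
  have hYker : vanishingIdeal Yc = f.ker := by
    rw [← Scheme.IdealSheafData.map_bot, ← Scheme.nilradical_eq_bot, ← Scheme.IdealSheafData.vanishingIdeal_top,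
      Scheme.IdealSheafData.map_vanishingIdeal]
    congr 1
    ext1
    change Set.range f = closure (f '' Set.univ)
    rw [Set.image_univ, f.isClosedEmbedding.isClosed_range.closure_eq]
  have hker : (vanishingIdeal Yc).subschemeι.ker = f.ker := by
    rw [Scheme.IdealSheafData.ker_subschemeι, hYker]
  haveI := IsClosedImmersion.isIso_lift _ f hker
  let e : (vanishingIdeal Yc).subscheme ≅ H := (asIso (IsClosedImmersion.lift _ f hker.le)).symm
  have hZ : (⟨closure (Yc : Set P), isClosed_closure⟩ : Closeds P) = Yc := Closeds.ext Yc.isClosed.closure_eq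
  -- REGULAR `H`: the empty chain
  by_cases hHreg : Scheme.IsRegular H
  · refine ⟨P, 𝟙 P, (Yc : Set P), fun Q h0 _ => h0, ?_, ?_⟩
    · simpa only [Category.id_comp] using hirr₀
    · rw [hZ]
      exact Scheme.IsRegular.of_iso e.inv hHreg
  -- otherwise `H` is a curve: `dim H ≤ 1`
  have hdimH : topologicalKrullDim H ≤ 1 := by
    by_contra h
    haveI := isIso_of_isClosedImmersion_projectiveSpace_of_not_dim_le_one ι hn h
    exact hHreg (Scheme.IsRegular.of_iso (inv ι) (isRegular_projectiveSpace n k))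
  -- generic point of `Y`; `Y` irreducible
  let ι₀ : H ⟶ P := e.inv ≫ (vanishingIdeal Yc).subschemeι
  have hrange : Set.range ι₀ = (Yc : Set P) := by
    rw [← Scheme.IdealSheafData.coe_support_vanishingIdeal Yc, ← Scheme.IdealSheafData.range_subschemeι]
    ext x
    constructor
    · rintro ⟨h, rfl⟩
      exact ⟨e.inv h, (Scheme.Hom.comp_apply _ _ h).symm⟩
    · rintro ⟨y, rfl⟩
      obtain ⟨h, rfl⟩ := e.inv.surjective y
      exact ⟨h, Scheme.Hom.comp_apply _ _ h⟩
  have hgen : IsGenericPoint (ι₀ (genericPoint H)) (Yc : Set P) := by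
    have h := (genericPoint_spec H).image ι₀.continuous
    rwa [Set.image_univ, ι₀.isClosedEmbedding.isClosed_range.closure_eq, hrange] at h
  have hYirr : IsIrreducible (Yc : Set P) := by
    have h := (isIrreducible_singleton (x := ι₀ (genericPoint H))).closure
    rwa [hgen] at h
  -- the first stage: finitely many non-regular points, good reduction everywhere, dimension ≤ 1
  have hfin₀ : (singSet (Yc : Set P)).Finite :=
    singSet_finite_of_iso Yc e (stub_singFinite_of_le_two p hp k n H ι hι hH hloc hn)
  have hdim₀ : topologicalKrullDim ↥(vanishingIdeal (⟨closure (Yc : Set P), isClosed_closure⟩ : Closeds P)).subscheme ≤ 1 :=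
    dim_le_of_iso Yc e hdimH
  -- the admissibility predicate E1 ∧ E2 over `P`
  obtain ⟨Adm, hAdm⟩ : ∃ Adm : (∀ X' : Scheme.{0}, (X' ⟶ P) → Set X' → X'.IdealSheafData → Prop),
      ∀ (X' : Scheme.{0}) (σ' : X' ⟶ P) (Y' : Set X') (C : X'.IdealSheafData), Adm X' σ' Y' C ↔
        ((C.support : Set X') ∩ (σ' ≫ q) ⁻¹' {IsLocalRing.closedPoint O} ⊆ Y' ∧ Smooth (C.subschemeι ≫ σ' ≫ q)) :=
    ⟨fun X' σ' Y' C => (C.support : Set X') ∩ (σ' ≫ q) ⁻¹' {IsLocalRing.closedPoint O} ⊆ Y' ∧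
      Smooth (C.subschemeι ≫ σ' ≫ q), fun _ _ _ _ => Iff.rfl⟩
  -- strong induction on the number of non-regular points, carrying the ADMISSIBLE chain / irreducibility / finiteness /
  -- good reduction / dim
  suffices key : ∀ (m : ℕ) (P₁ : Scheme.{0}) (σ₁ : P₁ ⟶ P) (S₁ : Set P₁),
      (∀ Q : (∀ X' : AlgebraicGeometry.Scheme.{0}, (X' ⟶ P) → Set X' → Prop),
        Q P (CategoryTheory.CategoryStruct.id P) (Yc : Set P) →
        (∀ (X' X'' : AlgebraicGeometry.Scheme.{0}) (σ' : X' ⟶ P) (Y' : Set X') (C : X'.IdealSheafData)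
          (τ : X'' ⟶ X'), Q X' σ' Y' → Literature.AlgebraicGeometry.Resolution.IsBlowup τ C →
          Literature.AlgebraicGeometry.Resolution.Scheme.IsRegular C.subscheme →
          σ' '' (C.support : Set X') ⊆ {x : P | ¬ IsGenericPoint x (Yc : Set P)} → Adm X' σ' Y' C →
          Q X'' (CategoryTheory.CategoryStruct.comp τ σ') (closure (τ ⁻¹' (Y' \ (C.support : Set X'))))) →
        Q P₁ σ₁ S₁) →
      IsIrreducible ((σ₁ ≫ q) ⁻¹' {IsLocalRing.closedPoint O}) →
      (singSet S₁).Finite →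
      GoodSet (σ₁ ≫ q) S₁ →
      topologicalKrullDim ↥(vanishingIdeal (⟨closure S₁, isClosed_closure⟩ : Closeds P₁)).subscheme ≤ 1 →
      (singSet S₁).ncard = m →
      ∃ (P' : Scheme.{0}) (σ : P' ⟶ P) (S' : Set P'),
        (∀ Q : (∀ X' : AlgebraicGeometry.Scheme.{0}, (X' ⟶ P) → Set X' → Prop),
          Q P (CategoryTheory.CategoryStruct.id P) (Yc : Set P) →
          (∀ (X' X'' : AlgebraicGeometry.Scheme.{0}) (σ' : X' ⟶ P) (Y' : Set X') (C : X'.IdealSheafData)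
            (τ : X'' ⟶ X'), Q X' σ' Y' → Literature.AlgebraicGeometry.Resolution.IsBlowup τ C →
            Literature.AlgebraicGeometry.Resolution.Scheme.IsRegular C.subscheme →
            σ' '' (C.support : Set X') ⊆ {x : P | ¬ IsGenericPoint x (Yc : Set P)} → Adm X' σ' Y' C →
            Q X'' (CategoryTheory.CategoryStruct.comp τ σ') (closure (τ ⁻¹' (Y' \ (C.support : Set X'))))) →
          Q P' σ S') ∧
        IsIrreducible ((σ ≫ q) ⁻¹' {IsLocalRing.closedPoint O}) ∧
        Scheme.IsRegular (vanishingIdeal (⟨closure S', isClosed_closure⟩ : Closeds P')).subscheme by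
    obtain ⟨P', σ, S', h1, h2, h3⟩ := key _ _ (𝟙 P) (Yc : Set P) (fun Q h0 _ => h0)
      (by simpa only [Category.id_comp] using hirr₀) hfin₀
      (fun x _ => by rw [Category.id_comp]; exact stub_goodAtOfSmooth O _ _ hq _) hdim₀ rfl
    refine ⟨P', σ, S', ?_, h2, h3⟩
    intro Q hQ0 hstep
    exact h1 Q hQ0 (fun X' X'' σ' Y' C τ hQ hbl hC hne hadm =>
      hstep X' X'' σ' Y' C τ hQ hbl hC hne ((hAdm X' σ' Y' C).mp hadm).1 ((hAdm X' σ' Y' C).mp hadm).2)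
  intro m
  induction m using Nat.strong_induction_on with
  | _ m ih =>
    intro P₁ σ₁ S₁ hch₁ hirr₁ hfin₁ hgood₁ hdim₁ hm
    by_cases hne : (singSet S₁).Nonempty
    · -- sections through points of the current strict transform are admissible for the pulled-back predicate
      have hAdm₁ : ∀ (X' : AlgebraicGeometry.Scheme.{0}) (σ' : X' ⟶ P₁) (Y' : Set X')
          (s : AlgebraicGeometry.Spec (.of O) ⟶ X'), AlgebraicGeometry.IsClosedImmersion s →
          CategoryTheory.CategoryStruct.comp s (CategoryTheory.CategoryStruct.comp σ'
            (CategoryTheory.CategoryStruct.comp σ₁ q)) = CategoryTheory.CategoryStruct.id _ →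
          s (IsLocalRing.closedPoint O) ∈ Y' →
          (fun X' τ T C => Adm X' (CategoryTheory.CategoryStruct.comp τ σ₁) T C) X' σ' Y' s.ker := by
        intro X' σ' Y' s hsci hs hsY
        have hs' : s ≫ (σ' ≫ σ₁) ≫ q = 𝟙 _ := by simpa only [Category.assoc] using hs
        exact (hAdm X' (σ' ≫ σ₁) Y' s.ker).mpr (adm_of_section q (σ' ≫ σ₁) Y' s hs' hsY)
      obtain ⟨P₂, σ₂, S₂, hdim₂, hch₂, hirr₂, hfin₂, hgood₂, hlt⟩ :=
        isolatedPointDrop_dimOne_adm O P P₁ q Yc σ₁ S₁ hq hqp hsub hYirr (admChain_chain Adm hch₁) hirr₁ hfin₁ hgood₁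
          hdim₁ (fun X' τ T C => Adm X' (CategoryTheory.CategoryStruct.comp τ σ₁) T C) hAdm₁ hne
      have hch' := admChain_comp hgen Adm hch₁ hch₂
      have hlt' : (singSet S₂).ncard < m := by
        rw [← hm]
        exact hlt
      refine ih _ hlt' P₂ (σ₂ ≫ σ₁) S₂ hch' ?_ hfin₂ ?_ hdim₂ rfl
      · simpa only [Category.assoc] using hirr₂
      · simpa only [GoodSet, GoodAt, Category.assoc] using hgood₂
    · refine ⟨P₁, σ₁, S₁, hch₁, hirr₁, fun x => ?_⟩
      by_contra hx
      exact hne ⟨x, hx⟩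

end Summit.ResolutionOfSingularities.ResolutionOfSingularities.Cruxes.EquisingularLiftNat.Sections

end
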